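import Summits.QuantumAdvantage.AdviceFreeQNC0.BlockCombGates37
import HarnessLib

/-!
# Cell qa-qnc0 — P-37c DEGREE FORMS: `Na_le_deg`, `blockComb_le_deg`, `gatesHardLogDeg`
# (planner qa-qnc0-p1 gen 37, source HOME/qa-qnc0-p1/exp37/BlockComb37.lean §14; in `Na_le` window-locality is used exactly once,
# through `hasDeg_of_windowLocal`, so the block-comb theorem and (G_log) hold for branch tables of `𝔽₂`-DEGREE `≤ 2(log₂ n)^C` in the
# walk bits — tables of low `𝔽₂`-degree in the letters, juntas on any `(log₂ n)^C` letters; THEOREM A (`AffBells22`) = no gates)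
-/

noncomputable section

open Classical

namespace Summit.QuantumAdvantage.AdviceFreeQNC0

open Finset
open Literature.Computability.MetaComplexity Literature.Computability.MetaComplexity.Smolensky
open F4 AffBells22 Subcube

namespace BlockFibre37

variable {n m : ℕ}
variable {K : ℕ}

/-! ### 14. DEGREE FORMS (additive; §§1–13 above are untouched = the text the tree port pinned)

In `Na_le` the hypothesis `WindowLocal r (G t)` is used exactly once, as `hasDeg_of_windowLocal (hloc (σ u)) g`.  Replacing it by
`hdeg : ∀ t g, HasDeg (G t g) (2 * r)` gives the block-comb theorem and (G_log) for branch tables of `𝔽₂`-DEGREE `≤ 2(log₂ n)^C`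
in the walk bits — e.g. tables of `𝔽₂`-degree `≤ 2(log₂ n)^C` in the LETTERS (affine in the walk bits), or juntas on any
`(log₂ n)^C` letters.  THEOREM A of the route (`AffBells22`: every low-`𝔽₂`-degree strategy) is the case of no gates. -/

/-- `Na_le` for branch tables of `𝔽₂`-degree `≤ 2r` (the proof of `Na_le` verbatim; window-locality was used only through
`hasDeg_of_windowLocal`). -/
theorem Na_le_deg (cd : CombData n K) {c₀ : ℝ} {m₀ : ℕ}
    (hcore : ∀ m ≥ m₀, ∀ D : ℕ, D ≤ Nat.sqrt m →
      ∀ f : (Fin m → Bool) → F4, f ∈ fullSpan m D → c₀ * (2 : ℝ) ^ m ≤ ((failSetOf f).card : ℝ))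
    {r : ℕ} {T : Type} (σ : (Fin n → Bool) → T) (G : T → Fin (n + 1) → (Fin n → Bool) → Bool)
    (hσ : ∀ (u : Fin n → Bool) (k : Fin K), cd.Good k u → σ (cpl cd.fam k u) = σ u)
    (hdeg : ∀ t g, HasDeg (G t g) (2 * r)) (c : ℕ) (a : Fin n → Bool)
    (hm : m₀ ≤ (GoodSet cd a).card) (hr : (2 * r + 1) ^ 2 ≤ (GoodSet cd a).card) :
    ((univ.filter fun v : Fin K → Bool =>
        ringWinU c (fun g u => G (σ u) g u) (blockExt cd.fam a v) = true).card : ℝ) ≤ (1 - c₀) * (2 : ℝ) ^ K := by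
  set S := GoodSet cd a with hS
  set s := S.card with hs
  set y : Fin (n + 1) → (Fin n → Bool) → Bool := fun g u => G (σ u) g u with hy
  -- (D) the sub-family fibre bound at every point of the full fibre
  have hD : ∀ v : Fin K → Bool,
      ((univ.filter fun w : Fin s → Bool => ringWinU c y (blockExt (sub cd.fam S) (blockExt cd.fam a v) w) = true).card
        : ℝ) ≤ (1 - c₀) * (2 : ℝ) ^ s := by
    intro v
    set u := blockExt cd.fam a v with hu
    have hgood : ∀ k ∈ S, cd.Good k u := by
      intro k hk
      rw [hS, GoodSet, mem_filter] at hk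
      rw [hu]; exact (good_blockExt_iff cd k a v).2 hk.2
    have hadm : ∀ j, Admissible (sub cd.fam S) u j := by
      intro j
      rw [admissible_sub]
      exact cd.good_adm _ _ (hgood _ (Finset.orderEmbOfFin_mem S rfl j))
    have hconst : ∀ w : Fin s → Bool, σ (blockExt (sub cd.fam S) u w) = σ u := by
      intro w
      rw [blockExt_sub]
      refine sigma_const cd σ hσ u K (iota S w) ?_ (fun k hk => hgood k (iota_mem hk))
      calc (univ.filter fun k => iota S w k = true).card ≤ (univ : Finset (Fin K)).card := card_le_card (filter_subset _ _)
        _ = K := by rw [card_univ, Fintype.card_fin]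
    have hdeg : ∀ g, HasDeg (fun w => y g (blockExt (sub cd.fam S) u w)) (2 * r) := by
      intro g
      have e : (fun w => y g (blockExt (sub cd.fam S) u w)) = fun w => G (σ u) g (blockExt (sub cd.fam S) u w) := by
        funext w; rw [hy]; simp only; rw [hconst w]
      rw [e]
      exact hasDeg_comp_blockExt (sub cd.fam S) u (hdeg (σ u) g)
    have hsq : 2 * r + 1 ≤ Nat.sqrt s := Nat.le_sqrt'.2 hr
    exact card_win_blockExt_le hcore (sub cd.fam S) hm u hadm hsq c y hdeg
  -- (B) second averaging + (C) re-basing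
  have hB := avg_identity (PhiS S) (PhiS_invol S) (fun v : Fin K → Bool => ringWinU c y (blockExt cd.fam a v) = true)
  have hB' : (2 : ℝ) ^ s * ((univ.filter fun v : Fin K → Bool => ringWinU c y (blockExt cd.fam a v) = true).card : ℝ)
      = ∑ v : Fin K → Bool, ((univ.filter fun w : Fin s → Bool =>
          ringWinU c y (blockExt (sub cd.fam S) (blockExt cd.fam a v) w) = true).card : ℝ) := by
    have e : ∀ v : Fin K → Bool, (univ.filter fun w : Fin s → Bool => ringWinU c y (blockExt cd.fam a (PhiS S w v)) = true)
        = univ.filter fun w : Fin s → Bool => ringWinU c y (blockExt (sub cd.fam S) (blockExt cd.fam a v) w) = true := by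
      intro v; refine filter_congr fun w _ => ?_; rw [blockExt_PhiS]
    have hB2 := hB
    rw [sum_congr rfl fun v _ => congrArg Finset.card (e v)] at hB2
    exact_mod_cast hB2
  have hsum : ∑ v : Fin K → Bool, ((univ.filter fun w : Fin s → Bool =>
      ringWinU c y (blockExt (sub cd.fam S) (blockExt cd.fam a v) w) = true).card : ℝ)
      ≤ (2 : ℝ) ^ K * ((1 - c₀) * (2 : ℝ) ^ s) := by
    have h := Finset.sum_le_card_nsmul (univ : Finset (Fin K → Bool)) _ ((1 - c₀) * (2 : ℝ) ^ s) (fun v _ => hD v)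
    rw [nsmul_eq_mul, card_univ, Fintype.card_fun, Fintype.card_bool, Fintype.card_fin] at h
    exact_mod_cast h
  have hpos : (0 : ℝ) < (2 : ℝ) ^ s := by positivity
  have key : (2 : ℝ) ^ s * ((univ.filter fun v : Fin K → Bool => ringWinU c y (blockExt cd.fam a v) = true).card : ℝ)
      ≤ (2 : ℝ) ^ s * ((1 - c₀) * (2 : ℝ) ^ K) := by rw [hB']; nlinarith
  exact le_of_mul_le_mul_left key hpos

/-- **THE BLOCK-COMB THEOREM, DEGREE FORM**: the branch tables need only have `𝔽₂`-degree `≤ 2(log₂ n)^C` in the walk bits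
(a window-local table of window `(log₂ n)^C` does, `hasDeg_of_windowLocal`; so does any table of `𝔽₂`-degree `≤ 2(log₂ n)^C` in
the LETTERS, which are affine in the walk bits). -/
theorem blockComb_le_deg : ∃ θ : ℝ, θ < 1 ∧ ∀ C : ℕ, ∃ A n₀ : ℕ, ∀ n ≥ n₀, ∀ (K : ℕ) (cd : CombData n K),
    A * (Nat.log 2 n) ^ (2 * C + 1) ≤ K → ∀ (c : ℕ) (T : Type) (σ : (Fin n → Bool) → T)
    (G : T → Fin (n + 1) → (Fin n → Bool) → Bool),
    (∀ (u : Fin n → Bool) (k : Fin K), cd.Good k u → σ (cpl cd.fam k u) = σ u) →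
    (∀ t g, HasDeg (G t g) (2 * (Nat.log 2 n) ^ C)) →
    ((univ.filter fun u : Fin n → Bool => ringWinU c (fun g u => G (σ u) g u) u = true).card : ℝ)
      ≤ θ * (2 : ℝ) ^ n := by
  obtain ⟨c₀, hc₀, m₀, hcore⟩ := failSet_ge_of_mem_fullSpan
  refine ⟨1 - c₀ / 2, by linarith, fun C => ⟨7 * (m₀ + 9) + 3, 2, fun n hn K cd hA c T σ G hσ hdeg => ?_⟩⟩
  have hn2 : 2 ≤ n := hn
  set L := Nat.log 2 n with hL
  set r := L ^ C with hr
  set t := m₀ + 9 * L ^ (2 * C) with ht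
  have hL1 : 1 ≤ L := Nat.le_log_of_pow_le (by norm_num) (by simpa using hn2)
  have hKn : K ≤ n := K_le_n cd
  have hnL : n < 2 ^ (L + 1) := Nat.lt_pow_succ_log_self (by norm_num) n
  -- room
  have hroom : (3 * L + 4) * t + 3 ≤ K := by
    have hL2C : 1 ≤ L ^ (2 * C) := Nat.one_le_pow _ _ hL1
    have hL2C1 : 1 ≤ L ^ (2 * C + 1) := Nat.one_le_pow _ _ hL1
    have a1 : m₀ ≤ m₀ * L ^ (2 * C) := Nat.le_mul_of_pos_right _ hL2C
    have a2 : t ≤ (m₀ + 9) * L ^ (2 * C) := by rw [ht, add_mul]; omega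
    have a3 : (3 * L + 4) * t ≤ 7 * L * ((m₀ + 9) * L ^ (2 * C)) :=
      le_trans (Nat.mul_le_mul_right _ (by omega)) (Nat.mul_le_mul_left _ a2)
    have a4 : 7 * L * ((m₀ + 9) * L ^ (2 * C)) = (7 * (m₀ + 9)) * L ^ (2 * C + 1) := by ring
    have a5 : (7 * (m₀ + 9) + 3) * L ^ (2 * C + 1) = (7 * (m₀ + 9)) * L ^ (2 * C + 1) + 3 * L ^ (2 * C + 1) := by ring
    have a6 := le_trans a3 (le_of_eq a4)
    rw [a5] at hA
    generalize (7 * (m₀ + 9)) * L ^ (2 * C + 1) = Y at a6 hA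
    omega
  have htK : t ≤ K := by nlinarith
  -- per-background counts
  set Q : (Fin n → Bool) → Prop := fun u => ringWinU c (fun g u => G (σ u) g u) u = true with hQ
  set N : (Fin n → Bool) → ℝ := fun a =>
    ((univ.filter fun v : Fin K → Bool => Q (blockExt cd.fam a v)).card : ℝ) with hN
  have hN1 : ∀ a, N a ≤ (2 : ℝ) ^ K := by
    intro a
    rw [hN]
    simp only
    have h : (univ.filter fun v : Fin K → Bool => Q (blockExt cd.fam a v)).card ≤ (univ : Finset (Fin K → Bool)).card :=
      card_le_card (filter_subset _ _)
    rw [card_univ, Fintype.card_fun, Fintype.card_bool, Fintype.card_fin] at h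
    exact_mod_cast h
  have hNg : ∀ a, ¬ (GoodSet cd a).card ≤ t → N a ≤ (1 - c₀) * (2 : ℝ) ^ K := by
    intro a ha
    rw [not_le] at ha
    have hm : m₀ ≤ (GoodSet cd a).card := by omega
    have hr1 : 1 ≤ r := Nat.one_le_pow _ _ hL1
    have hrr : (2 * r + 1) ^ 2 ≤ (GoodSet cd a).card := by
      have h9 : (2 * r + 1) ^ 2 ≤ 9 * r ^ 2 := by nlinarith
      have h9' : 9 * r ^ 2 = 9 * L ^ (2 * C) := by rw [hr, ← pow_mul, mul_comm C 2]
      omega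
    exact Na_le_deg cd hcore σ G hσ hdeg c a hm hrr
  -- bad backgrounds
  set bad := univ.filter fun a : Fin n → Bool => (GoodSet cd a).card ≤ t with hbad
  set good := univ.filter fun a : Fin n → Bool => ¬ (GoodSet cd a).card ≤ t with hgood
  have hbadR : (bad.card : ℝ) ≤ (2 : ℝ) ^ n / 2 := by
    have h1 := card_fewGood_le cd htK
    have h2 := choose_mul_pow_le_half hKn hnL hroom
    have h3 : (K.choose t : ℝ) * (3 / 4 : ℝ) ^ (K - t) * (2 : ℝ) ^ n ≤ 1 / 2 * (2 : ℝ) ^ n :=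
      mul_le_mul_of_nonneg_right h2 (by positivity)
    rw [hbad]
    linarith
  have hcards : (bad.card : ℝ) + good.card = (2 : ℝ) ^ n := by
    have h := card_filter_add_card_filter_not (s := (univ : Finset (Fin n → Bool)))
      (fun a : Fin n → Bool => (GoodSet cd a).card ≤ t)
    rw [card_univ, Fintype.card_fun, Fintype.card_bool, Fintype.card_fin] at h
    rw [hbad, hgood]
    exact_mod_cast h
  -- (A) first averaging
  have hA0 := avg_identity (fun (v : Fin K → Bool) (a : Fin n → Bool) => blockExt cd.fam a v)
    (fun v a => blockExt_invol cd.fam a v) Q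
  have hAR : (2 : ℝ) ^ K * ((univ.filter fun u : Fin n → Bool => Q u).card : ℝ) = ∑ a : Fin n → Bool, N a := by
    show (2 : ℝ) ^ K * ((univ.filter fun u : Fin n → Bool => Q u).card : ℝ)
      = ∑ a : Fin n → Bool, ((univ.filter fun v : Fin K → Bool => Q (blockExt cd.fam a v)).card : ℝ)
    exact_mod_cast hA0
  have hsplit : ∑ a : Fin n → Bool, N a = ∑ a ∈ bad, N a + ∑ a ∈ good, N a := by
    rw [hbad, hgood]; exact (sum_filter_add_sum_filter_not _ _ _).symm
  have hb : ∑ a ∈ bad, N a ≤ bad.card * (2 : ℝ) ^ K := by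
    have := Finset.sum_le_card_nsmul bad N ((2 : ℝ) ^ K) (fun a _ => hN1 a)
    rwa [nsmul_eq_mul] at this
  have hg : ∑ a ∈ good, N a ≤ good.card * ((1 - c₀) * (2 : ℝ) ^ K) := by
    have := Finset.sum_le_card_nsmul good N ((1 - c₀) * (2 : ℝ) ^ K)
      (fun a ha => hNg a (by rw [hgood, mem_filter] at ha; exact ha.2))
    rwa [nsmul_eq_mul] at this
  have hpos : (0 : ℝ) < (2 : ℝ) ^ K := by positivity
  have hc1 : c₀ ≤ 1 := by
    -- from the core bound at any admissible instance: use `hN1`/`hNg` consistency is not needed; derive from hcore at m₀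
    by_contra hlt
    rw [not_le] at hlt
    have h := hcore m₀ le_rfl 0 (Nat.zero_le _) 0 (Submodule.zero_mem _)
    have hle : ((failSetOf (0 : (Fin m₀ → Bool) → F4)).card : ℝ) ≤ (2 : ℝ) ^ m₀ := by
      have := card_le_card (filter_subset (fun u : Fin m₀ → Bool => tr ((0 : (Fin m₀ → Bool) → F4) u) ≠ 1) univ)
      rw [card_univ, Fintype.card_fun, Fintype.card_bool, Fintype.card_fin] at this
      exact_mod_cast this
    have hp : (0 : ℝ) < (2 : ℝ) ^ m₀ := by positivity
    nlinarith
  have key : (2 : ℝ) ^ K * ((univ.filter fun u : Fin n → Bool => Q u).card : ℝ)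
      ≤ (2 : ℝ) ^ K * ((1 - c₀ / 2) * (2 : ℝ) ^ n) := by
    rw [hAR, hsplit]
    have hgc : (good.card : ℝ) = (2 : ℝ) ^ n - bad.card := by linarith
    rw [hgc] at hg
    have hc' : c₀ * (bad.card : ℝ) ≤ c₀ * ((2 : ℝ) ^ n / 2) := mul_le_mul_of_nonneg_left hbadR hc₀.le
    nlinarith [hb, hg, hc', hpos, hc1]
  exact le_of_mul_le_mul_left key hpos

/-- **(G_log, DEGREE FORM)**: up to `log₃ n − O_C(log log n)` common dense `MOD₃` gates feeding one arbitrary selector of branch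
tables of `𝔽₂`-DEGREE `≤ 2(log₂ n)^C` in the walk bits (e.g. any `𝔽₂`-polynomials of degree `≤ 2(log₂ n)^C` in the letters):
constant loss.  THEOREM A of the route (all low-`𝔽₂`-degree strategies, `AffBells22`) is the case `r = 0`. -/
theorem gatesHardLogDeg : ∃ θ : ℝ, θ < 1 ∧ ∀ C : ℕ, ∃ n₀ : ℕ, ∀ n ≥ n₀, ∀ r : ℕ, 3 ^ r * (Nat.log 2 n) ^ (2 * C + 2) ≤ n →
    ∀ (ℓ : Fin r → Fin (n + 1) → ZMod 3) (c : ℕ) (T : Type)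
    (f : (Fin r → ZMod 3) → T) (G : T → Fin (n + 1) → (Fin n → Bool) → Bool),
    (∀ t g, HasDeg (G t g) (2 * (Nat.log 2 n) ^ C)) →
    ((univ.filter fun u : Fin n → Bool =>
        ringWinU c (fun g u => G (f (fun i => gateSum (ℓ i) u)) g u) u = true).card : ℝ) ≤ θ * (2 : ℝ) ^ n := by
  obtain ⟨θ, hθ, hmain⟩ := blockComb_le_deg
  refine ⟨θ, hθ, fun C => ?_⟩
  obtain ⟨A, n₀, hA⟩ := hmain C
  refine ⟨max n₀ (2 ^ (4 * A + 8)), fun n hn r hr ℓ c T f G hdeg => ?_⟩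
  have hn0 : n₀ ≤ n := le_trans (le_max_left _ _) hn
  have hn1 : 2 ^ (4 * A + 8) ≤ n := le_trans (le_max_right _ _) hn
  have hL : 4 * A + 8 ≤ Nat.log 2 n := Nat.le_log_of_pow_le (by norm_num) hn1
  have hK : A * (Nat.log 2 n) ^ (2 * C + 1) ≤ KR r n := by
    unfold KR
    have e : (Nat.log 2 n) ^ (2 * C + 2) = (Nat.log 2 n) ^ (2 * C + 1) * Nat.log 2 n := pow_succ _ _
    rw [e] at hr
    have hP : 1 ≤ (Nat.log 2 n) ^ (2 * C + 1) := Nat.one_le_pow _ _ (by omega)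
    generalize (Nat.log 2 n) ^ (2 * C + 1) = P at hr hP ⊢
    generalize Nat.log 2 n = L at hr hL ⊢
    have ht : 1 ≤ 3 ^ r := Nat.one_le_pow _ _ (by norm_num)
    generalize 3 ^ r = t at hr ht ⊢
    have hAPt : A * P ≤ A * P * t := Nat.le_mul_of_pos_right _ ht
    have htP : t ≤ t * P := Nat.le_mul_of_pos_right _ hP
    have h1 : (A * P + 2) * (t + 3) ≤ (4 * A + 8) * (t * P) := by nlinarith [hAPt, htP, ht, hP]
    have h2 : (A * P + 2) * (t + 3) ≤ n :=
      le_trans h1 (le_trans (Nat.mul_le_mul_right _ hL) (by nlinarith [hr]))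
    have h3 : A * P + 2 ≤ n / (t + 3) := (Nat.le_div_iff_mul_le (by omega)).2 h2
    omega
  exact hA n hn0 (KR r n) (gateCDR ℓ) hK c T (fun u => f (fun i => gateSum (ℓ i) u)) G
    (fun u k hk => congrArg f (funext fun i => gateSum_cplR ℓ k u hk i)) hdeg

end BlockFibre37

end Summit.QuantumAdvantage.AdviceFreeQNC0
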